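/-
Copyright: cell pub-rosobs (carver-g59). INSTRUMENT for engine 1's W(f) toy model — NOT a resolution theorem.
-/
import Mathlib.Algebra.MvPolynomial.CommRing
import Mathlib.Algebra.MvPolynomial.Variables
import Mathlib.RingTheory.MvPolynomial.Basic
import Mathlib.RingTheory.MvPolynomial.WeightedHomogeneous
import Mathlib.Data.ZMod.Basic
import Mathlib.Data.Matrix.Basic
import Mathlib.Data.Matrix.Mul
import Mathlib.Data.Fin.VecNotation
import Mathlib.Tactic.LinearCombination
import Mathlib.Tactic.FinCases
import HarnessLib

/-!
# EXAMPLE L′: a light-fed IMPURE shift on the `W`-class below `1/(p+1)` (THEOREM-LT §15, CARVER T72) — kernel-checked over `𝔽₃`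

Instrument — NOT a resolution theorem, NOT a statement about the invariant of [AbramovichTemkinWlodarczyk2024], NOT summit progress;
AI review weaker than expert review.  Engine 1's EXAMPLE L′ (THEOREM-LT-eng1-g38 §15, C448b; CARVER-NOTES T72: "smallest test object for a typed
(P)+isotropy predicate") in the cell's `W(f)` TOY MODEL at `p = 3`: slots `(f; W₁, W₂; y) = (X₀; X₁, X₂; X₃)`, weights `(⅓; ¼, ¼; ⅙)`, parameter
`σ = X₄` of weight `1/12`,
  `g = f³ − W₁³W₂ + fW₁²y`,  `Φ = (f += σW₁;  W₂ += σy + σ³)`.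
The point of L′ (T72): with a slot below `1/(p+1)` the `W`-class isotropy is NOT of THEOREM U's shape — `W₂` takes the IMPURE, light-fed shift `σy`
next to the pure `σ³` — so formal statements of THEOREM U / C3 / PROPOSITION F must carry `w_min = 1/(p+1)` ((R0)) as a HYPOTHESIS.
Typed here, by proof for all group elements at once (the evaluation trick of `WeightedCentreExampleL` / `WeightedCentreTruncation` §BlockDiagonal, inlined):
* `aeval_isoVecP_gLp` — `Φ` is an isotropy (`g∘Φ = g`, Frobenius in char 3); `isWeightedHomogeneous_isoVecP` — `Φ` is graded of degree `1/12`
  (`Φ(W₂) = W₂ + σy + σ³` has weight `¼ = 1/12 + ⅙ = 3/12`).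
* CLASS `y` (bottom): `mem_vars_gLp_piLp` — for every substitution `f ↦ af + cy²`, `W ↦ BW`, `y ↦ λy`, `σ ↦ σ` with `a ≠ 0`, `B` invertible, `λ ≠ 0`
  (any `c`), `y` occurs in `g∘Π` (evaluate at `W = B'e₁`, compare `y = t` with `y = 0` at `f = 0, 1`; a `decide` over `𝔽₃³`).
* CLASS `W`: the `W`-carrying part of the truncation at `¼` is `W₁³W₂` — literally EXAMPLE L's, `WeightedCentreExampleL.mem_vars_GW_linW` (not restated);
  CLASS `f`: the truncation at `⅓` is `f³` in the single variable `f` (nothing to check).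
NOT here: that every graded automorphism has the shape `(a, c, B, λ)` (weight count; engine), "sharp", EXAMPLE L″, CONJECTURE L-U (modelling / engine).

References: weighted blow-ups / gradings [cite: AbramovichTemkinWlodarczyk2024, §5.1 (p. 1575)]; substitution and evaluation of polynomials
[cite: Lang2002, Ch. IV §1]; the example is engine 1's, the formalisation ours.
-/

open MvPolynomial

namespace Literature.AlgebraicGeometry.Resolution.WeightedBlowup

namespace ExampleLPrime

/-- EXAMPLE L′'s face `g = f³ − W₁³W₂ + fW₁²y` in `𝔽₃[f, W₁, W₂, y, σ]` (derived here from the engine's text). [cite: AbramovichTemkinWlodarczyk2024, §5.1 (p. 1575)] -/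
noncomputable def gLp : MvPolynomial (Fin 5) (ZMod 3) :=
  X 0 ^ 3 - X 1 ^ 3 * X 2 + X 0 * X 1 ^ 2 * X 3

/-- `Φ = (f ↦ f + σW₁; W₂ ↦ W₂ + σy + σ³)`, `W₁, y, σ` fixed (derived here). [cite: AbramovichTemkinWlodarczyk2024, §5.1 (p. 1575)] -/
noncomputable def isoVecP : Fin 5 → MvPolynomial (Fin 5) (ZMod 3) :=
  ![X 0 + X 4 * X 1, X 1, X 2 + X 4 * X 3 + X 4 ^ 3, X 3, X 4]

/-- **`Φ` is an isotropy of `g`** (EXAMPLE L′; `(f + σW₁)³ = f³ + σ³W₁³` in char 3, and the cross terms `∓σW₁³y` cancel; derived here).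
[cite: AbramovichTemkinWlodarczyk2024, §5.1 (p. 1575)] -/
theorem aeval_isoVecP_gLp : aeval isoVecP gLp = gLp := by
  have h3 : (3 : MvPolynomial (Fin 5) (ZMod 3)) = 0 := by
    simpa using CharP.cast_eq_zero (MvPolynomial (Fin 5) (ZMod 3)) 3
  simp only [gLp, isoVecP, map_add, map_sub, map_mul, map_pow, aeval_X, Matrix.cons_val_zero, Matrix.cons_val_one,
    Matrix.cons_val]
  linear_combination (X 0 ^ 2 * X 4 * X 1 + X 0 * X 4 ^ 2 * X 1 ^ 2) * h3

/-- EXAMPLE L′'s weights `(⅓; ¼, ¼; ⅙)` and the degree `1/12` of `σ` (derived here). [cite: AbramovichTemkinWlodarczyk2024, §5.1 (p. 1575)] -/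
def wLp : Fin 5 → ℚ := ![1/3, 1/4, 1/4, 1/6, 1/12]

/-- **`Φ` is GRADED of degree `1/12`**, including the IMPURE light-fed term: `Φ(W₂) = W₂ + σy + σ³` is weighted homogeneous of weight `¼`
(`1/12 + ⅙ = 3·(1/12) = ¼`; derived here). [cite: AbramovichTemkinWlodarczyk2024, §5.1 (p. 1575)] -/
theorem isWeightedHomogeneous_isoVecP (i : Fin 5) : IsWeightedHomogeneous wLp (isoVecP i) (wLp i) := by
  have hX : ∀ j : Fin 5, IsWeightedHomogeneous wLp (X j : MvPolynomial (Fin 5) (ZMod 3)) (wLp j) :=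
    fun j => isWeightedHomogeneous_X (ZMod 3) wLp j
  fin_cases i
  · have h := (hX 4).mul (hX 1)
    have e : wLp 4 + wLp 1 = wLp 0 := by simp [wLp]; norm_num
    rw [e] at h
    simpa [isoVecP] using (hX 0).add h
  · simpa [isoVecP] using hX 1
  · have h := (hX 4).mul (hX 3)
    have e : wLp 4 + wLp 3 = wLp 2 := by simp [wLp]; norm_num
    rw [e] at h
    have h' := (hX 4).pow 3
    have e' : 3 • wLp 4 = wLp 2 := by simp [wLp]; norm_num
    rw [e'] at h'
    simpa [isoVecP] using ((hX 2).add h).add h'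
  · simpa [isoVecP] using hX 3
  · simpa [isoVecP] using hX 4

/-! ## Class `y` (bottom): `y` occurs in `g∘Π` -/

/-- The graded substitutions of EXAMPLE L′'s weights: `f ↦ af + cy²`, `W ↦ BW`, `y ↦ λy`, `σ ↦ σ` (derived here; that every graded automorphism
has this shape is the engine's weight count, not typed). [cite: AbramovichTemkinWlodarczyk2024, §5.1 (p. 1575)] -/
noncomputable def piLp (a c : ZMod 3) (B : Matrix (Fin 2) (Fin 2) (ZMod 3)) (lam : ZMod 3) : Fin 5 → MvPolynomial (Fin 5) (ZMod 3) :=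
  ![C a * X 0 + C c * X 3 ^ 2, C (B 0 0) * X 1 + C (B 0 1) * X 2, C (B 1 0) * X 1 + C (B 1 1) * X 2, C lam * X 3, X 4]

/-- The evaluation point `(f, W, y, σ) = (x, u, t, 0)` (bookkeeping). [cite: Lang2002, Ch. IV §1] -/
def ptP (x : ZMod 3) (u : Fin 2 → ZMod 3) (t : ZMod 3) : Fin 5 → ZMod 3 := ![x, u 0, u 1, t, 0]

/-- Values of `g∘Π` (bookkeeping). [cite: Lang2002, Ch. IV §1] -/
theorem eval_aeval_gLp (π : Fin 5 → MvPolynomial (Fin 5) (ZMod 3)) (ε : Fin 5 → ZMod 3) :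
    eval ε (aeval π gLp) = eval ε (π 0) ^ 3 - eval ε (π 1) ^ 3 * eval ε (π 2) + eval ε (π 0) * eval ε (π 1) ^ 2 * eval ε (π 3) := by
  simp only [gLp, map_add, map_sub, map_mul, map_pow, aeval_X]

/-- Values of the structured substitution at `(x, u, t, 0)` (bookkeeping). [cite: Lang2002, Ch. IV §1] -/
theorem eval_piLp (a c : ZMod 3) (B : Matrix (Fin 2) (Fin 2) (ZMod 3)) (lam x : ZMod 3) (u : Fin 2 → ZMod 3) (t : ZMod 3) :
    eval (ptP x u t) (piLp a c B lam 0) = a * x + c * t ^ 2 ∧ eval (ptP x u t) (piLp a c B lam 1) = (B.mulVec u) 0 ∧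
    eval (ptP x u t) (piLp a c B lam 2) = (B.mulVec u) 1 ∧ eval (ptP x u t) (piLp a c B lam 3) = lam * t := by
  simp [piLp, ptP, Matrix.mulVec, dotProduct, Fin.sum_univ_two]

/-- **CLASS `y` of EXAMPLE L′** (C448b; derived here by proof for all `a ≠ 0`, all `c`, all invertible `B`, all `λ ≠ 0`): `y ∈ vars (g∘Π)` — the monomial
`aλ·f·(BW)₁²·y` survives.  Proof: evaluate at `W = B'e₁` (so `BW = e₁`): the value `(ax + ct²)³ + (ax + ct²)λt` would be independent of `t`; at
`x = 0, 1`, `t = 1` versus `t = 0` this is impossible in `𝔽₃`. [cite: AbramovichTemkinWlodarczyk2024, §5.1 (p. 1575)] -/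
theorem mem_vars_gLp_piLp (a c : ZMod 3) (B B' : Matrix (Fin 2) (Fin 2) (ZMod 3)) (hB : B * B' = 1) (lam : ZMod 3) (ha : a ≠ 0)
    (hlam : lam ≠ 0) : (3 : Fin 5) ∈ (aeval (piLp a c B lam) gLp).vars := by
  by_contra hy
  have H : ∀ x t : ZMod 3,
      (a * x + c * t ^ 2) ^ 3 - 1 ^ 3 * 0 + (a * x + c * t ^ 2) * 1 ^ 2 * (lam * t)
        = (a * x + c * 0 ^ 2) ^ 3 - 1 ^ 3 * 0 + (a * x + c * 0 ^ 2) * 1 ^ 2 * (lam * 0) := by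
    intro x t
    have h5 : ∀ i : Fin 5, i ≠ 3 → ptP x (B'.mulVec ![1, 0]) t i = ptP x (B'.mulVec ![1, 0]) 0 i := by
      intro i hi
      fin_cases i <;> simp_all [ptP]
    -- a variable absent from `g∘Π` cannot influence its values (the evaluation trick of `WeightedCentreExampleL`)
    have E : eval (ptP x (B'.mulVec ![1, 0]) t) (aeval (piLp a c B lam) gLp)
        = eval (ptP x (B'.mulVec ![1, 0]) 0) (aeval (piLp a c B lam) gLp) :=
      hom_congr_vars (by ext r; simp) (fun i hi _ => by rw [eval_X, eval_X]; exact h5 i fun him => hy (him ▸ hi)) rfl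
    obtain ⟨h0, h1, h2, h3⟩ := eval_piLp a c B lam x (B'.mulVec ![1, 0]) t
    obtain ⟨k0, k1, k2, k3⟩ := eval_piLp a c B lam x (B'.mulVec ![1, 0]) 0
    rw [eval_aeval_gLp, eval_aeval_gLp, h0, h1, h2, h3, k0, k1, k2, k3, Matrix.mulVec_mulVec, hB, Matrix.one_mulVec] at E
    simpa using E
  have e0 := H 0 1
  have e1 := H 1 1
  clear H hy
  revert ha hlam e0 e1
  revert a c lam
  decide

end ExampleLPrime

end Literature.AlgebraicGeometry.Resolution.WeightedBlowup
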